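import Mathlib
import HarnessLib
import Summits.Ventures.LatticeQCDFlow.Exactness.InvolutiveMetropolis

/-!
# Microcanonical over-relaxation: an action-preserving, Haar-preserving involution is exact with acceptance one

HONEST FRAMING: exact (Metropolis-corrected) sampling algorithms for lattice gauge theory;
figures of merit are autocorrelation/cost numbers at stated couplings and volumes; no
continuum-physics claim.

Venture `LatticeQCDFlow` (cell pub-lqcd), topic `Exactness`, FANOUT row 9 (eng-latcore, the
engine `latflow.core`).  NEW WORK of the cell over Mathlib; nothing here is cited as a fact.
Printed counterparts, named only: Adler 1981, Creutz 1987 and Brown–Woch 1987 (over-relaxation),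
de Forcrand–Jahn 2005 (SU(N) over-relaxation through SU(2) subgroups).

The engine's `updates.or_sweep` / the `nOR` part of `composite_sweep` (1 HB + n OR, the cell's
cost unit) applies, link by link and SU(2) subgroup by subgroup, the reflection
`U ↦ ŝ U⁻¹ ŝ` (`ŝ` = the normalised staple projection), which CONSERVES the Wilson action and is
accepted with probability one (acceptance test A5: `|ΔS|/S < 1e−12`).  Its exactness is the
degenerate case of the HMC skeleton `InvolutiveMetropolis.involMH_isReversible` (row 30): when
`H ∘ Φ = H` the Metropolis test always accepts and the kernel IS the deterministic map.

## Content

* `involAcceptE_eq_one_of_invariant`, `involMH_eq_deterministic` — if `H (Φ x) = H x` for all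
  `x`, the deterministic-proposal Metropolis kernel equals `Kernel.deterministic Φ`;
* `microcanonical_isReversible` / `_invariant` — a `vol`-preserving INVOLUTION that conserves
  `H` is, as a deterministic kernel, reversible for `e^{−H} vol` (for every measurable `H`);
* §2 the group instance: `reflectThrough s : g ↦ s g⁻¹ s` is an involution of any group
  (`reflectThrough_involutive`) and preserves every measure that is left-, right- and
  inversion-invariant (`measurePreserving_reflectThrough`; Haar measure of a compact group);
  `overrelaxation_isReversible` / `_invariant`: for every measurable `H` with
  `H (s g⁻¹ s) = H g` the over-relaxation move is exact for `e^{−H} · Haar`.  (For SU(2) and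
  `H g = −k Re tr (g R†)`, `R = |R| ŝ`: `Re tr ((ŝ g⁻¹ ŝ) R†) = |R| Re tr (ŝ g⁻¹) = |R| Re tr (g ŝ†)
  = Re tr (g R†)` since SU(2) traces are real and `tr h⁻¹ = tr h†` — the model-specific identity
  the engine checks numerically, not typed here.)

Not here: ergodicity (over-relaxation alone is NOT ergodic — it conserves `H`; the heat-bath hit
supplies ergodicity), the composition over links/subgroups (`SequentialScanAdjoint.lean`,
`ClassSweep.lean`).
-/

namespace Summit.Ventures.LatticeQCDFlow.Exactness

open MeasureTheory ProbabilityTheory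
open scoped ENNReal

variable {Ω : Type*} [MeasurableSpace Ω]

/-! ## §1 Conserved `H`: the Metropolis test always accepts -/

omit [MeasurableSpace Ω] in
/-- If `H` is `Φ`-invariant the acceptance probability `min {1, e^{H x − H (Φ x)}}` is one. -/
theorem involAcceptE_eq_one_of_invariant {H : Ω → ℝ} {Φ : Ω → Ω} (hH : ∀ x, H (Φ x) = H x)
    (x : Ω) : involAcceptE H Φ x = 1 := by
  simp [involAcceptE, involAccept, hH x]

/-- **Microcanonical moves need no coin**: for `Φ`-invariant `H` the deterministic-proposal
Metropolis kernel is the deterministic kernel of `Φ`. -/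
theorem involMH_eq_deterministic {H : Ω → ℝ} {Φ : Ω → Ω} (hΦ : Measurable Φ) (hHm : Measurable H)
    (hH : ∀ x, H (Φ x) = H x) : involMH Φ hΦ H = Kernel.deterministic Φ hΦ := by
  ext x B hB
  rw [involMH_apply hHm x hB, involAcceptE_eq_one_of_invariant hH, Kernel.deterministic_apply,
    Measure.dirac_apply' _ hB, tsub_self, zero_mul, add_zero, one_mul]

/-- **Over-relaxation skeleton.**  A `vol`-preserving involution `Φ` that conserves `H` is, as a
deterministic Markov kernel, reversible with respect to `e^{−H} vol` — exact with acceptance one,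
for every measurable `H`. -/
theorem microcanonical_isReversible {vol : Measure Ω} {H : Ω → ℝ} {Φ : Ω → Ω} (hHm : Measurable H)
    (hinv : Function.Involutive Φ) (hvol : MeasurePreserving Φ vol vol) (hH : ∀ x, H (Φ x) = H x) :
    Kernel.IsReversible (Kernel.deterministic Φ hvol.measurable)
      (vol.withDensity fun x => ENNReal.ofReal (Real.exp (-H x))) := by
  rw [← involMH_eq_deterministic hvol.measurable hHm hH]
  exact involMH_isReversible hHm hinv hvol

/-- … hence `e^{−H} vol` is invariant under the microcanonical move. -/
theorem microcanonical_invariant {vol : Measure Ω} {H : Ω → ℝ} {Φ : Ω → Ω} (hHm : Measurable H)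
    (hinv : Function.Involutive Φ) (hvol : MeasurePreserving Φ vol vol) (hH : ∀ x, H (Φ x) = H x) :
    Kernel.Invariant (Kernel.deterministic Φ hvol.measurable)
      (vol.withDensity fun x => ENNReal.ofReal (Real.exp (-H x))) := by
  rw [← involMH_eq_deterministic hvol.measurable hHm hH]
  exact involMH_invariant hHm hinv hvol

/-! ## §2 The group reflection `g ↦ s g⁻¹ s` -/

section Group

variable {G : Type*} [Group G]

/-- The **over-relaxation reflection** through `s`: `g ↦ s g⁻¹ s` (SU(2): `s` = the normalised
staple projection; in SU(N) applied inside each SU(2) subgroup). -/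
def reflectThrough (s : G) : Equiv.Perm G where
  toFun g := s * g⁻¹ * s
  invFun g := s * g⁻¹ * s
  left_inv g := by simp [mul_inv_rev, mul_assoc]
  right_inv g := by simp [mul_inv_rev, mul_assoc]

/-- Pointwise formula for the reflection. -/
@[simp] theorem reflectThrough_apply (s g : G) : reflectThrough s g = s * g⁻¹ * s := rfl

/-- The reflection is an involution. -/
theorem reflectThrough_involutive (s : G) : Function.Involutive (reflectThrough s) :=
  (reflectThrough s).left_inv

/-- The reflection fixes `s` (it is the "antipode through `s`"). -/
theorem reflectThrough_self (s : G) : reflectThrough s s = s := by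
  simp

variable [MeasurableSpace G] [MeasurableMul G] [MeasurableInv G]

/-- The reflection preserves every left-, right- and inversion-invariant measure (the Haar measure
of a compact group): it is `(· * s) ∘ (s * ·) ∘ (·)⁻¹`. -/
theorem measurePreserving_reflectThrough (μ : Measure G) [μ.IsMulLeftInvariant]
    [μ.IsMulRightInvariant] [μ.IsInvInvariant] (s : G) :
    MeasurePreserving (reflectThrough s) μ μ := by
  have h : (⇑(reflectThrough s)) = (· * s) ∘ (s * ·) ∘ Inv.inv := by
    funext g; rfl
  rw [h]
  exact (measurePreserving_mul_right μ s).comp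
    ((measurePreserving_mul_left μ s).comp (Measure.measurePreserving_inv μ))

/-- **Over-relaxation is exact.**  For every measurable `H` conserved by the reflection
(`H (s g⁻¹ s) = H g`) and every left-, right- and inversion-invariant `μ`, the deterministic move
`g ↦ s g⁻¹ s` is reversible with respect to `e^{−H} μ`. -/
theorem overrelaxation_isReversible {μ : Measure G} [μ.IsMulLeftInvariant] [μ.IsMulRightInvariant]
    [μ.IsInvInvariant] {H : G → ℝ} (hHm : Measurable H) (s : G) (hH : ∀ g, H (s * g⁻¹ * s) = H g) :
    Kernel.IsReversible
      (Kernel.deterministic (reflectThrough s) (measurePreserving_reflectThrough μ s).measurable)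
      (μ.withDensity fun g => ENNReal.ofReal (Real.exp (-H g))) :=
  microcanonical_isReversible hHm (reflectThrough_involutive s) (measurePreserving_reflectThrough μ s)
    (fun g => hH g)

/-- … and `e^{−H} μ` is invariant under the over-relaxation move. -/
theorem overrelaxation_invariant {μ : Measure G} [μ.IsMulLeftInvariant] [μ.IsMulRightInvariant]
    [μ.IsInvInvariant] {H : G → ℝ} (hHm : Measurable H) (s : G) (hH : ∀ g, H (s * g⁻¹ * s) = H g) :
    Kernel.Invariant
      (Kernel.deterministic (reflectThrough s) (measurePreserving_reflectThrough μ s).measurable)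
      (μ.withDensity fun g => ENNReal.ofReal (Real.exp (-H g))) :=
  microcanonical_invariant hHm (reflectThrough_involutive s) (measurePreserving_reflectThrough μ s)
    (fun g => hH g)

end Group

end Summit.Ventures.LatticeQCDFlow.Exactness
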